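import Summits.Ventures.CertifiedQuantumChemistry.Rows.SubsystemRows
import Literature.MathematicalPhysics.QuantumChemistry.SubsystemSectorConstraints
import HarnessLib

/-!
# Ventures/CertifiedQuantumChemistry — Rows/SubsystemSectorRows.lean: SECTOR-RESOLVED SUBSYSTEM ROWS
# (two prices `μ_α`, `μ_β`; fragment SECTOR floors) in the cell's lower-bound programmes
# (LADDER-CHEM I-TYPE slots 10 + 02b row-level glue; X1-a door; I-DIFF (c))

HONEST FRAMING (verbatim, page 1 of every file of the cell): certified bounds for a stated model
Hamiltonian in a stated basis; not a claim about the real molecule or material beyond that model.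

WHAT THIS FILE IS. The sibling of `Rows/SubsystemRows.lean` (chem-type-02: the printed total-`N`
subsystem row of Verstichel–van Aggelen–Van Neck–Ayers–Bultinck, J. Chem. Phys. 132 (2010) 114113,
§2.3 eq. (24)) for the `(N_α, N_β)`-SECTOR refinement proved in
`Literature/MathematicalPhysics/QuantumChemistry/SubsystemSectorConstraints.lean`
(`isNecessaryInSector_subsystemSectorConstraint`): for a SPIN-COMPATIBLE fragment — spatial orbitals
`φ : Fin kA ↪o Fin k` of the full model, spin orbitals `orbEmb φ` — every state of the full system puts
on the fragment a fractional occupation ensemble resolved by `(N_α^frag, N_β^frag)`, so the fragment's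
SECTOR energies (not only its total-`N` energies) floor the fragment energy functional. In the cell's
vocabulary (`Model k`, `LowerRow`, `IsNecessaryInSector`, `PosMapFeasible`):

* `FragmentSectorFloor FA L` — the CERTIFIED INPUT: rational `L a b ≤ E(H_{FA}; a, b)` for EVERY
  fragment sector `a, b ≤ kA` — literally the cell's own rows `LowerRow FA a b (L a b)` of the fragment
  model `FA : Model kA`, including the vacuum `(0, 0)` and the one-spin sectors (a producer must
  certify the whole rectangle; chem-ref-4 F5 note 2026-08-26). `FragmentEnergyFloor.fragmentSectorFloor`:
  a total-`N` floor is a sector floor (`E₀(H; a + b) ≤ E(H; a, b)`, `Rows/SpinSectors.lean`), so the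
  sector input is never harder to produce than the total-`N` one.
* `IsTwoPriceMinorant kA L m μa μb` — `m + μa·a + μb·b ≤ L a b` on the rectangle (a supporting plane
  of the floor points; rational arithmetic, `isTwoPriceMinorant_iff`); an `IsAffineMinorant` of a
  total-`N` floor is the equal-price plane (`IsAffineMinorant.isTwoPriceMinorant`).
* `SubsystemSectorRow FA φ m μa μb γ Γ` — THE ROW on pairs `(γ, Γ)` of the FULL system:
  `m + μa · Re Σ_p γ_{φp↑,φp↑} + μb · Re Σ_p γ_{φp↓,φp↓} ≤ Re E[H_{FA}](γ|_{orbEmb φ}, Γ|_{orbEmb φ})`,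
  affine in `(γ, Γ)`; with `μa = μb` it is chem-type-02's `SubsystemRow FA (orbEmb φ) μ m`
  (`subsystemSectorRow_iff_subsystemRow`).
* `subsystemSectorRow_isNecessaryInSector` — floor + plane ⇒ the row is NECESSARY in every full-system
  sector; `lowerRow_of_forall_necessary_subsystemSectorRows` / `lowerRow_of_forall_dqg_subsystemSectorRows`:
  "base programme + sector subsystem rows" is a sound lower-bound programme;
  `subsystemSectorBlock` + `posMapFeasible_subsystemSectorBlocks_iff` +
  `isNecessaryInSector_posMapFeasible_subsystemSectorBlocks`: the rows as `1 × 1` positive blocks for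
  the dual-cone certificate of `Rows/DualConeLowerRow.lean` (one multiplier `ν ≥ 0` per row).

Nothing here asserts a bound; every statement is an implication from certified inputs. Everything is
PROVED (0 sorry); four definitions (floor predicate, plane predicate, row, block). WHAT THIS IS NOT: no
number, no row of record; spin-INcompatible spin-orbital subsets and general one-particle subspaces are
not covered (orbital rotation first); the choice of the fragment tables `FA` is a modelling freedom
outside the kernel (ANY symmetric fragment tables give a valid row).

References: B. Verstichel et al., J. Chem. Phys. 132 (2010) 114113, §2.2 eq. (12), §2.3 eq. (24)
[cite: VerstichelEtAl2010Subsystem, §2.3 eq. (24)]; E. Cancès, G. Stoltz, M. Lewin, J. Chem. Phys. 125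
(2006) 064101, §3 eqs. (7)–(10) (arbitrary necessary condition lists; dual cone)
[cite: CancesStoltzLewin2006, §3 eqs. (7)-(10)]. Tree: `Rows/SubsystemRows.lean` (total-`N` sibling, whose
docstring lists this refinement under "not here"), `Literature/…/SubsystemSectorConstraints.lean`
(the theorem), `Rows/SpinSectors.lean` (`groundEnergy_le_sectorGroundEnergy`), `Rows/DualConeLowerRow.lean`.
-/

noncomputable section

namespace Summit.Ventures.CertifiedQuantumChemistry

open Matrix Finset
open Literature.MathematicalPhysics.QuantumLattice Literature.MathematicalPhysics.QuantumChemistry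
open scoped ComplexOrder

variable {k kA : ℕ}

/-! ## Certified inputs: fragment SECTOR floors and two-price supporting planes -/

/-- **FRAGMENT SECTOR FLOOR**: rational lower bounds `L a b` of the `(N_α, N_β) = (a, b)` sector ground
energies of the fragment model `FA : Model kA` for EVERY `a, b ≤ kA` — the cell's own `LowerRow`s of the
fragment (exact / FCI-class certificates for a small fragment, SDP lower bounds for a larger one; the
vacuum and one-spin sectors included). The sector analogue of `FragmentEnergyFloor`.
[cite: VerstichelEtAl2010Subsystem, §2.3 eq. (24)] -/
def FragmentSectorFloor (FA : Model kA) (L : ℕ → ℕ → ℚ) : Prop :=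
  ∀ a b : ℕ, a ≤ kA → b ≤ kA → LowerRow FA a b (L a b)

/-- Unfolding: a sector floor is a rectangle of inequalities `L a b ≤ E(H_{FA}; a, b)`.
[cite: VerstichelEtAl2010Subsystem, §2.3 eq. (24)] -/
theorem fragmentSectorFloor_iff (FA : Model kA) (L : ℕ → ℕ → ℚ) :
    FragmentSectorFloor FA L ↔ ∀ a b : ℕ, a ≤ kA → b ≤ kA → ((L a b : ℚ) : ℝ) ≤ FA.energy a b := by
  refine ⟨fun h a b ha hb => (h a b ha hb).2.2, fun h a b ha hb => ⟨ha, hb, h a b ha hb⟩⟩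

/-- A sector floor may be weakened entrywise. [cite: VerstichelEtAl2010Subsystem, §2.3 eq. (24)] -/
theorem FragmentSectorFloor.mono {FA : Model kA} {L L' : ℕ → ℕ → ℚ} (h : FragmentSectorFloor FA L)
    (hle : ∀ a b, a ≤ kA → b ≤ kA → L' a b ≤ L a b) : FragmentSectorFloor FA L' :=
  fun a b ha hb => ⟨ha, hb, le_trans (by exact_mod_cast hle a b ha hb) (h a b ha hb).2.2⟩

/-- **A total-`N` floor is a sector floor**: `L (a + b) ≤ E₀(H_{FA}; a + b) ≤ E(H_{FA}; a, b)`
(`groundEnergy_le_sectorGroundEnergy`, `Rows/SpinSectors.lean`) — the sector input is never harder to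
certify than the total-`N` input of `Rows/SubsystemRows.lean`. [cite: VerstichelEtAl2010Subsystem, §2.2 eq. (12)] -/
theorem FragmentEnergyFloor.fragmentSectorFloor {FA : Model kA} {L : ℕ → ℚ}
    (h : FragmentEnergyFloor FA L) : FragmentSectorFloor FA fun a b => L (a + b) := by
  intro a b ha hb
  refine ⟨ha, hb, le_trans (h (a + b) (by omega)) ?_⟩
  exact groundEnergy_le_sectorGroundEnergy FA.hamiltonian (by simpa using ha) (by simpa using hb)

/-- **TWO-PRICE SUPPORTING PLANE** of a sector floor: `m + μa·a + μb·b ≤ L a b` for all `a, b ≤ kA`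
(a plane below the points `(a, b, L a b)`; pure rational arithmetic on the row data). The sector
analogue of `IsAffineMinorant`. [cite: VerstichelEtAl2010Subsystem, §2.2 eqs. (10)-(12)] -/
def IsTwoPriceMinorant (kA : ℕ) (L : ℕ → ℕ → ℚ) (m μa μb : ℚ) : Prop :=
  ∀ a b : ℕ, a ≤ kA → b ≤ kA → m + μa * a + μb * b ≤ L a b

/-- The plane test as a bounded check over `Finset.range (kA + 1)²` (the form `decide` / `norm_num`
evaluate on literal data). [cite: VerstichelEtAl2010Subsystem, §2.2 eqs. (10)-(12)] -/
theorem isTwoPriceMinorant_iff (kA : ℕ) (L : ℕ → ℕ → ℚ) (m μa μb : ℚ) :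
    IsTwoPriceMinorant kA L m μa μb ↔
      ∀ a ∈ Finset.range (kA + 1), ∀ b ∈ Finset.range (kA + 1), m + μa * a + μb * b ≤ L a b := by
  simp only [IsTwoPriceMinorant, Finset.mem_range, Nat.lt_succ_iff]
  exact ⟨fun h a ha b hb => h a b ha hb, fun h a b ha hb => h a ha b hb⟩

/-- An affine minorant `α·M + β` of a total-`N` floor is the EQUAL-PRICE plane `(β, α, α)` of the
induced sector floor. [cite: VerstichelEtAl2010Subsystem, §2.2 eqs. (10)-(12)] -/
theorem IsAffineMinorant.isTwoPriceMinorant {L : ℕ → ℚ} {α β : ℚ} (h : IsAffineMinorant kA L α β) :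
    IsTwoPriceMinorant kA (fun a b => L (a + b)) β α α := by
  intro a b ha hb
  have h' := h (a + b) (by omega)
  push_cast at h' ⊢
  linarith

/-- Floor and plane together bound the fragment SECTOR energies affinely:
`m + μa·a + μb·b ≤ E(H_{FA}; a, b)` for `a, b ≤ kA = |Fin kA|` — the hypothesis shape `hm` of
`Literature…isNecessaryInSector_subsystemSectorConstraint`. [cite: VerstichelEtAl2010Subsystem, §2.3 eq. (24)] -/
theorem affine_le_sectorGroundEnergy_of_sectorFloor {FA : Model kA} {L : ℕ → ℕ → ℚ}
    (hL : FragmentSectorFloor FA L) {m μa μb : ℚ} (hmin : IsTwoPriceMinorant kA L m μa μb) (a b : ℕ)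
    (ha : a ≤ Fintype.card (Fin kA)) (hb : b ≤ Fintype.card (Fin kA)) :
    (m : ℝ) + (μa : ℝ) * a + (μb : ℝ) * b ≤
      sectorGroundEnergy (molecularHamiltonian (fun p q => (FA.h p q : ℂ))
        (fun p q r s => (FA.eri p q r s : ℂ)) (FA.ecore : ℂ)) a b := by
  rw [Fintype.card_fin] at ha hb
  have h1 := hmin a b ha hb
  have h2 := (hL a b ha hb).2.2
  rw [Model.energy] at h2
  exact le_trans (by exact_mod_cast h1) h2

/-! ## The sector-resolved subsystem ROW and its necessity -/

/-- **SECTOR-RESOLVED SUBSYSTEM ROW** of a fragment (`FA : Model kA`, spin-compatible embedding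
`φ : Fin kA ↪o Fin k`, plane `(m, μa, μb)`): the predicate on pairs `(γ, Γ)` of the FULL system
`m + μa · Re Σ_p γ_{φp↑, φp↑} + μb · Re Σ_p γ_{φp↓, φp↓} ≤ Re E[H_{FA}](γ|_{orbEmb φ}, Γ|_{orbEmb φ})` — affine
in `(γ, Γ)`, two prices for the fragment's up and down occupations. [cite: VerstichelEtAl2010Subsystem, §2.3 eq. (24)] -/
def SubsystemSectorRow (FA : Model kA) (φ : Fin kA ↪o Fin k) (m μa μb : ℚ)
    (γ : Matrix (Orb (Fin k)) (Orb (Fin k)) ℂ)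
    (Γ : Matrix (Orb (Fin k) × Orb (Fin k)) (Orb (Fin k) × Orb (Fin k)) ℂ) : Prop :=
  (m : ℝ) + (μa : ℝ) * (∑ p : Fin kA, γ (orb (φ p) 0) (orb (φ p) 0)).re +
      (μb : ℝ) * (∑ p : Fin kA, γ (orb (φ p) 1) (orb (φ p) 1)).re ≤
    (rdmEnergy (fun p q => (FA.h p q : ℂ)) (fun p q r s => (FA.eri p q r s : ℂ)) (FA.ecore : ℂ)
      (γ.submatrix (orbEmb φ) (orbEmb φ))
      (Γ.submatrix (Prod.map (orbEmb φ) (orbEmb φ)) (Prod.map (orbEmb φ) (orbEmb φ)))).re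

/-- The trace of the fragment block of `γ` along `orbEmb φ` is the sum of the two spin-resolved
occupation sums (`N̄ = N̄_α + N̄_β`). [cite: VerstichelEtAl2010Subsystem, §2.3 eq. (14)] -/
theorem trace_submatrix_orbEmb (φ : Fin kA ↪o Fin k) (γ : Matrix (Orb (Fin k)) (Orb (Fin k)) ℂ) :
    (γ.submatrix (orbEmb φ) (orbEmb φ)).trace =
      ∑ p : Fin kA, γ (orb (φ p) 0) (orb (φ p) 0) + ∑ p : Fin kA, γ (orb (φ p) 1) (orb (φ p) 1) := by
  rw [Matrix.trace, ← Finset.sum_add_distrib]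
  rw [← Fintype.sum_equiv (Equiv.refl _)
    (fun o : Orb (Fin kA) => Matrix.diag (γ.submatrix (orbEmb φ) (orbEmb φ)) o)
    (fun o => Matrix.diag (γ.submatrix (orbEmb φ) (orbEmb φ)) o) (fun _ => rfl)]
  rw [show (∑ o : Orb (Fin kA), Matrix.diag (γ.submatrix (orbEmb φ) (orbEmb φ)) o) =
      ∑ x : Fin kA × Fin 2, Matrix.diag (γ.submatrix (orbEmb φ) (orbEmb φ)) (toLex x) from
    (Fintype.sum_equiv toLex _ _ (fun _ => rfl)).symm]
  rw [Fintype.sum_prod_type]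
  refine Finset.sum_congr rfl fun p _ => ?_
  rw [Fin.sum_univ_two]
  rfl

/-- **Equal prices recover the total-`N` row**: `SubsystemSectorRow FA φ m μ μ = SubsystemRow FA (orbEmb φ) μ m`
(`μ · Re Tr γ|_e + m`, chem-type-02's row). [cite: VerstichelEtAl2010Subsystem, §2.3 eq. (24)] -/
theorem subsystemSectorRow_iff_subsystemRow (FA : Model kA) (φ : Fin kA ↪o Fin k) (m μ : ℚ)
    (γ : Matrix (Orb (Fin k)) (Orb (Fin k)) ℂ)
    (Γ : Matrix (Orb (Fin k) × Orb (Fin k)) (Orb (Fin k) × Orb (Fin k)) ℂ) :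
    SubsystemSectorRow FA φ m μ μ γ Γ ↔ SubsystemRow FA (orbEmb φ) μ m γ Γ := by
  rw [SubsystemSectorRow, SubsystemRow, trace_submatrix_orbEmb, Complex.add_re]
  constructor <;> intro h <;> linarith

/-- **The sector-resolved subsystem row is a NECESSARY condition in every sector** `(N_α, N_β) = (a, b)`
of the full system, for a symmetric fragment model with a certified sector floor and a two-price plane
(`Literature…isNecessaryInSector_subsystemSectorConstraint`). [cite: VerstichelEtAl2010Subsystem, §2.3 eq. (24)] -/
theorem subsystemSectorRow_isNecessaryInSector {FA : Model kA} (hFA : FA.IsSymmetric) {L : ℕ → ℕ → ℚ}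
    (hL : FragmentSectorFloor FA L) {m μa μb : ℚ} (hmin : IsTwoPriceMinorant kA L m μa μb)
    (φ : Fin kA ↪o Fin k) (a b : ℕ) :
    IsNecessaryInSector a b (SubsystemSectorRow FA φ m μa μb) :=
  isNecessaryInSector_subsystemSectorConstraint φ a b (Model.hamiltonian_isHermitian hFA)
    (affine_le_sectorGroundEnergy_of_sectorFloor hL hmin)

/-! ## Soundness of "base programme + sector subsystem rows" -/

/-- **LOWER ROW FROM A NECESSARY BASE CONDITION PLUS SECTOR SUBSYSTEM ROWS.** Symmetric model `F`,
physical sector `a, b ≤ k`, a base condition `C₀` necessary in the sector (e.g. `IsDQGFeasibleSector a b`),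
and a family of sector rows (symmetric fragments `FA i : Model (kA i)`, spin-compatible embeddings
`φ i`, sector floors `L i` with planes `(m i, μa i, μb i)`). If the rational `lo` lies below `Re E_F` on
every pair satisfying `C₀` and all the rows, then `LowerRow F a b lo`.
[cite: VerstichelEtAl2010Subsystem, §2.3 eq. (24)] -/
theorem lowerRow_of_forall_necessary_subsystemSectorRows {F : Model k} (hF : F.IsSymmetric) {a b : ℕ}
    (ha : a ≤ k) (hb : b ≤ k)
    {C₀ : Matrix (Orb (Fin k)) (Orb (Fin k)) ℂ →
      Matrix (Orb (Fin k) × Orb (Fin k)) (Orb (Fin k) × Orb (Fin k)) ℂ → Prop}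
    (hC₀ : IsNecessaryInSector a b C₀) {ι' : Type*} {kA : ι' → ℕ} (FA : ∀ i, Model (kA i))
    (hFA : ∀ i, (FA i).IsSymmetric) (φ : ∀ i, Fin (kA i) ↪o Fin k) {L : ι' → ℕ → ℕ → ℚ}
    {m μa μb : ι' → ℚ} (hL : ∀ i, FragmentSectorFloor (FA i) (L i))
    (hmin : ∀ i, IsTwoPriceMinorant (kA i) (L i) (m i) (μa i) (μb i)) {lo : ℚ}
    (hlo : ∀ γ Γ, C₀ γ Γ → (∀ i, SubsystemSectorRow (FA i) (φ i) (m i) (μa i) (μb i) γ Γ) →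
      ((lo : ℚ) : ℝ) ≤ (rdmEnergy (fun p q => (F.h p q : ℂ)) (fun p q r s => (F.eri p q r s : ℂ))
        (F.ecore : ℂ) γ Γ).re) :
    LowerRow F a b lo :=
  lowerRow_of_forall_necessary hF ha hb
    (hC₀.and (isNecessaryInSector_iForall fun i =>
      subsystemSectorRow_isNecessaryInSector (hFA i) (hL i) (hmin i) (φ i) a b))
    fun γ Γ h => hlo γ Γ h.1 h.2

/-- **The DQG programme with sector subsystem rows is a sound lower-bound programme**: instance
`C₀ = IsDQGFeasibleSector a b`. [cite: VerstichelEtAl2010Subsystem, §3 (P, Q, G with subspace constraints)] -/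
theorem lowerRow_of_forall_dqg_subsystemSectorRows {F : Model k} (hF : F.IsSymmetric) {a b : ℕ}
    (ha : a ≤ k) (hb : b ≤ k) {ι' : Type*} {kA : ι' → ℕ} (FA : ∀ i, Model (kA i))
    (hFA : ∀ i, (FA i).IsSymmetric) (φ : ∀ i, Fin (kA i) ↪o Fin k) {L : ι' → ℕ → ℕ → ℚ}
    {m μa μb : ι' → ℚ} (hL : ∀ i, FragmentSectorFloor (FA i) (L i))
    (hmin : ∀ i, IsTwoPriceMinorant (kA i) (L i) (m i) (μa i) (μb i)) {lo : ℚ}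
    (hlo : ∀ γ Γ, IsDQGFeasibleSector a b γ Γ →
      (∀ i, SubsystemSectorRow (FA i) (φ i) (m i) (μa i) (μb i) γ Γ) →
      ((lo : ℚ) : ℝ) ≤ (rdmEnergy (fun p q => (F.h p q : ℂ)) (fun p q r s => (F.eri p q r s : ℂ))
        (F.ecore : ℂ) γ Γ).re) :
    LowerRow F a b lo :=
  lowerRow_of_forall_necessary_subsystemSectorRows hF ha hb (isNecessaryInSector_isDQGFeasibleSector a b)
    FA hFA φ hL hmin hlo

/-! ## Sector subsystem rows as `1 × 1` positive blocks (dual-cone certificate of slot 07) -/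

/-- The SLACK of a sector subsystem row as a `1 × 1` complex diagonal block
`[Re E[H_{FA}](γ|, Γ|) − m − μa Re Σ γ_{↑↑} − μb Re Σ γ_{↓↓}]`; positive semidefinite iff the row holds.
[cite: CancesStoltzLewin2006, §3 eq. (7)] -/
def subsystemSectorBlock (FA : Model kA) (φ : Fin kA ↪o Fin k) (m μa μb : ℚ)
    (γ : Matrix (Orb (Fin k)) (Orb (Fin k)) ℂ)
    (Γ : Matrix (Orb (Fin k) × Orb (Fin k)) (Orb (Fin k) × Orb (Fin k)) ℂ) : Matrix Unit Unit ℂ :=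
  Matrix.diagonal fun _ =>
    (((rdmEnergy (fun p q => (FA.h p q : ℂ)) (fun p q r s => (FA.eri p q r s : ℂ)) (FA.ecore : ℂ)
          (γ.submatrix (orbEmb φ) (orbEmb φ))
          (Γ.submatrix (Prod.map (orbEmb φ) (orbEmb φ)) (Prod.map (orbEmb φ) (orbEmb φ)))).re -
      ((m : ℝ) + (μa : ℝ) * (∑ p : Fin kA, γ (orb (φ p) 0) (orb (φ p) 0)).re +
        (μb : ℝ) * (∑ p : Fin kA, γ (orb (φ p) 1) (orb (φ p) 1)).re) : ℝ) : ℂ)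

/-- The `1 × 1` block is positive semidefinite iff the sector row holds.
[cite: CancesStoltzLewin2006, §3 eq. (7)] -/
theorem posSemidef_subsystemSectorBlock_iff (FA : Model kA) (φ : Fin kA ↪o Fin k) (m μa μb : ℚ)
    (γ : Matrix (Orb (Fin k)) (Orb (Fin k)) ℂ)
    (Γ : Matrix (Orb (Fin k) × Orb (Fin k)) (Orb (Fin k) × Orb (Fin k)) ℂ) :
    (subsystemSectorBlock FA φ m μa μb γ Γ).PosSemidef ↔ SubsystemSectorRow FA φ m μa μb γ Γ := by
  rw [subsystemSectorBlock, posSemidef_diagonal_iff, SubsystemSectorRow]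
  constructor
  · intro h
    have h0 := h ()
    rw [Complex.zero_le_real] at h0
    linarith
  · intro h _
    rw [Complex.zero_le_real]
    linarith

/-- A family of sector rows is the `PosMapFeasible` family of its blocks.
[cite: CancesStoltzLewin2006, §3 eq. (7)] -/
theorem posMapFeasible_subsystemSectorBlocks_iff {ι' : Type*} [Fintype ι'] {kA : ι' → ℕ}
    (FA : ∀ i, Model (kA i)) (φ : ∀ i, Fin (kA i) ↪o Fin k) (m μa μb : ι' → ℚ)
    (γ : Matrix (Orb (Fin k)) (Orb (Fin k)) ℂ)
    (Γ : Matrix (Orb (Fin k) × Orb (Fin k)) (Orb (Fin k) × Orb (Fin k)) ℂ) :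
    PosMapFeasible (fun i => subsystemSectorBlock (FA i) (φ i) (m i) (μa i) (μb i)) γ Γ ↔
      ∀ i, SubsystemSectorRow (FA i) (φ i) (m i) (μa i) (μb i) γ Γ := by
  simp only [PosMapFeasible, posSemidef_subsystemSectorBlock_iff]

/-- **The block family of certified sector rows is a necessary positive-map family** in every sector —
the hypothesis `hL` of `lowerRow_of_dualCone_certificate` for these blocks (one multiplier `ν_i ≥ 0`
per row). [cite: CancesStoltzLewin2006, §3 eqs. (7)-(10)] -/
theorem isNecessaryInSector_posMapFeasible_subsystemSectorBlocks {ι' : Type*} [Fintype ι'] {kA : ι' → ℕ}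
    (FA : ∀ i, Model (kA i)) (hFA : ∀ i, (FA i).IsSymmetric) (φ : ∀ i, Fin (kA i) ↪o Fin k)
    {L : ι' → ℕ → ℕ → ℚ} {m μa μb : ι' → ℚ} (hL : ∀ i, FragmentSectorFloor (FA i) (L i))
    (hmin : ∀ i, IsTwoPriceMinorant (kA i) (L i) (m i) (μa i) (μb i)) (a b : ℕ) :
    IsNecessaryInSector a b
      (PosMapFeasible fun i => subsystemSectorBlock (FA i) (φ i) (m i) (μa i) (μb i)) :=
  (isNecessaryInSector_iForall fun i =>
      subsystemSectorRow_isNecessaryInSector (hFA i) (hL i) (hmin i) (φ i) a b).mono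
    fun γ Γ h => (posMapFeasible_subsystemSectorBlocks_iff FA φ m μa μb γ Γ).2 h

end Summit.Ventures.CertifiedQuantumChemistry
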